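import Literature.Computability.Complexity.KarpCliqueNP
import Literature.Computability.Complexity.CanonicalCodes
import Literature.Computability.Complexity.ListBricks
import Literature.Combinatorics.SimpleGraph.HamiltonianCycleListings
import HarnessLib

/-!
# `HAMCIRCUIT ∈ NP`: the vertex-list verifier in `P` (Karp 1972, Main Theorem, problem 10)

Membership half of the discharge of `Literature.Computability.Complexity.isNPComplete_HAMCIRCUIT`
(`KarpProblems.lean`; R. M. Karp, *Reducibility among combinatorial problems*, 1972, §4, Main
Theorem, problem 10, (UNDIRECTED) HAMILTON CIRCUIT). Karp: "It is clear that these problems (or,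
more precisely, their encodings into `Σ*`), are all in NP" (§4, after the list); Arora–Barak 2009,
proof of Thm. 2.17: "the ordered list of vertices in the path can serve as a certificate". This file
proves `HAMCIRCUIT ∈ NP` for the tree's `HAMCIRCUIT = encodingGraph.toLanguage hamCircuitSet`
(`NP = polyExists P`, `Nondeterministic.lean`) at the machine level, in the tree's algebra of `FP`
string functions (no machine is written), following `KarpCliqueNP.lean` (`CLIQUE ∈ NP`):

* **the graph-code language** `HamNP.gcodeLang ∈ P`: the graph-code test `CliqueNP.codeT` of
  `KarpCliqueNP.lean` run on `⟨x, ε⟩` (a `CLIQUE` instance with `k = 0`) accepts exactly the codes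
  `encodingGraph.encode ⟨n, G⟩` (`gcodeT_eq_true_iff`);
* **the certificate**: the vertex list `l = [v₀, …, v_{n-1}]` of a Hamiltonian cycle, coded as a
  list of unary numerals (`unaryEncodingNat.listBool`, `listCode l = ⟨1ⁿ, ⟨1^{v₀}, ⟨…, ε⟩⟩⟩`);
* **the verifier** `HamNP.verifT ∈ FP` (one bit) on `⟨x, y⟩`, `x = ⟨bin n, bits⟩`: accept iff
  `n = 1` (Mathlib: the one-vertex graph is Hamiltonian), or `n ≥ 3` and `y` is a CANONICAL list
  code (`CanonCode.canonListFn onesFn` fixes it) of exactly `n` items, all shorter than `1ⁿ`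
  (`Brick.allFn`, `ltLenF`), pairwise distinct (`Brick.nodupFn`), consecutive items adjacent
  (`Brick.chainFn`, the adjacency bit `bits[v + n u]` read by `bitAtFn`) and the last item adjacent
  to the first (`HashBricks.nthItemFn`); its truth on the code of ANY graph paired with ANY string is
  `verifT_encode_eq_true_iff`;
* **assembly** `HAMCIRCUIT_mem_NP`: `HAMCIRCUIT = gcodeLang ⊓ witnessLang` through the listing form of
  Hamiltonicity (`isHamiltonian_iff_exists_isHamCycleListing`,
  `Combinatorics/SimpleGraph/HamiltonianCycleListings.lean`), then `inter_P_mem_polyExists`.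

## References

* R. M. Karp, *Reducibility among combinatorial problems*, in: R. E. Miller, J. W. Thatcher (eds.),
  Complexity of Computer Computations, Plenum 1972, 85–103: §3 Def. 4 (NP), §4 Main Theorem
  (problem 10, HAMILTON CIRCUIT) and the remark "these problems … are all in NP".
* S. Arora, B. Barak, *Computational Complexity: A Modern Approach*, CUP 2009, Def. 2.1 (`NP` by
  certificates), Thm. 2.17 (proof: the vertex list as certificate), §0.1, §1.3.
-/

noncomputable section

namespace Literature.Computability.Complexity

open _root_.Computability Brick OracleCompose Plumb HashBricks Polynomial CanonCode
open Literature.Combinatorics.SimpleGraph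

namespace HamNP

/-! ### The graph-code language -/

/-- The graph-code test: `CliqueNP.codeT` on `⟨x, ε⟩`. [cite: AroraBarakCC2009, §0.1] -/
def gcodeT : List Bool → List Bool := CliqueNP.codeT ∘ fanoutFn id fun _ => []

/-- `gcodeT ∈ FP`. [cite: AroraBarakCC2009, §1.3] -/
theorem gcodeT_mem_FP : gcodeT ∈ FP :=
  comp_mem_FP CliqueNP.codeT_mem_FP (fanoutFn_mem_FP id_mem_FP (const_mem_FP _))

/-- `gcodeT` is one-bit. [folklore] -/
theorem oneBit_gcodeT : OneBit gcodeT := CliqueNP.oneBit_codeT.comp _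

/-- **`gcodeT x = [1]` iff `x` is the code of a graph.** [cite: AroraBarakCC2009, §0.1] -/
theorem gcodeT_eq_true_iff (x : List Bool) :
    gcodeT x = [true] ↔ ∃ (n : ℕ) (G : SimpleGraph (Fin n)), x = encodingGraph.encode ⟨n, G⟩ := by
  rw [gcodeT, Function.comp_apply, fanoutFn_apply, CliqueNP.codeT_eq_true_iff]
  constructor
  · rintro ⟨n, G, k, h⟩
    exact ⟨n, G, (Prod.mk.inj (boolPair_injective (a₁ := (x, [])) (a₂ := (_, _)) h)).1⟩
  · rintro ⟨n, G, rfl⟩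
    exact ⟨n, G, 0, rfl⟩

/-- **The language of graph codes.** [cite: Karp1972, §4 Main Theorem, problem 10] -/
def gcodeLang : Language Bool := {x | gcodeT x = [true]}

/-- `gcodeLang ∈ P`. [cite: AroraBarakCC2009, Def. 1.13 and §1.3] -/
theorem gcodeLang_mem_P : gcodeLang ∈ Classes.P := CliqueNP.mem_P_of_oneBit gcodeT_mem_FP oneBit_gcodeT

/-- Membership in `gcodeLang`. [folklore] -/
theorem mem_gcodeLang_iff (x : List Bool) :
    x ∈ gcodeLang ↔ ∃ (n : ℕ) (G : SimpleGraph (Fin n)), x = encodingGraph.encode ⟨n, G⟩ :=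
  gcodeT_eq_true_iff x

/-! ### The certificate: a list of unary numerals -/

/-- The code of the vertex list `l`: `⟨1^{|l|}, ⟨1^{l₀}, ⟨1^{l₁}, … ε⟩⟩⟩`
(`unaryEncodingNat.listBool`). [cite: AroraBarakCC2009, Thm. 2.17 (proof: the vertex list as certificate)] -/
def listCode (l : List ℕ) : List Bool := unaryEncodingNat.listBool.encode l

/-- The list code, field by field. [cite: AroraBarakCC2009, §0.1] -/
theorem listCode_eq (l : List ℕ) : listCode l = boolPair (ones l.length) (encList (l.map ones)) := by
  have hmap : l.map unaryEncodingNat.encode = l.map ones :=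
    List.map_congr_left fun v _ => (unaryEncodeNat_eq_replicate v : unaryEncodeNat v = _)
  rw [listCode, listBool_encode_eq_encList, unaryEncodeNat_eq_replicate, hmap]

/-- Length of the code of a list of numbers below `n`. [folklore] -/
theorem length_encList_map_ones_le {n : ℕ} : ∀ {l : List ℕ}, (∀ v ∈ l, v < n) →
    (encList (l.map ones)).length ≤ l.length * (2 * n + 2)
  | [], _ => by simp
  | a :: l, h => by
    have ha := h a (by simp)
    have ih := length_encList_map_ones_le (l := l) fun v hv => h v (by simp [hv])
    rw [List.map_cons, encList_cons, length_boolPair]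
    simp only [List.length_replicate, List.length_cons]
    nlinarith

/-- **The certificate is short**: `|listCode l| ≤ 2n² + 4n + 2` for a list of `n` numbers below `n`.
[folklore] -/
theorem length_listCode_le {n : ℕ} {l : List ℕ} (hl : l.length = n) (h : ∀ v ∈ l, v < n) :
    (listCode l).length ≤ 2 * n * n + 4 * n + 2 := by
  rw [listCode_eq, length_boolPair]
  have := length_encList_map_ones_le h
  rw [hl] at this
  simp only [List.length_replicate, hl]
  nlinarith

/-- **Canonical list codes**: a string is fixed by `canonListFn onesFn` iff it is a `listCode`.
[folklore] -/
theorem canonListFn_onesFn_eq_self_iff (y : List Bool) :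
    canonListFn onesFn y = y ↔ ∃ l : List ℕ, y = listCode l := by
  have key := fun w => canonListFn_eq unaryEncodingNat List.length (fun _ => rfl) (ci := onesFn) (fun _ => rfl) w
  constructor
  · intro h
    exact ⟨_, by rw [← h, (key y).2]; rfl⟩
  · rintro ⟨l, rfl⟩
    have h1 := (key (listCode l)).1
    have h2 := (key (listCode l)).2
    rw [h2]
    unfold listCode at h1 ⊢
    rw [unaryEncodingNat.listBool.decode_encode] at h1
    rw [← Option.some.inj h1]

/-! ### Projections of `w = ⟨x, y⟩`, `x = ⟨nc, bits⟩`, `y = ⟨hdr, L⟩` -/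

/-- The header of the certificate. [folklore] -/
def hdrW : List Bool → List Bool := fstF ∘ sndF
/-- The item list of the certificate. [folklore] -/
def itemsW : List Bool → List Bool := sndF ∘ sndF
/-- `1ⁿ` (bounded conversion of the numeral field `CliqueNP.ncF = fstF ∘ fstF`, ruler `w`). [folklore] -/
def unW : List Bool → List Bool := binToUnaryFn ∘ fanoutFn id CliqueNP.ncF

/-- `hdrW ∈ FP`. [cite: AroraBarakCC2009, §1.3] -/
theorem hdrW_mem_FP : hdrW ∈ FP := comp_mem_FP fstF_mem_FP sndF_mem_FP
/-- `itemsW ∈ FP`. [cite: AroraBarakCC2009, §1.3] -/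
theorem itemsW_mem_FP : itemsW ∈ FP := comp_mem_FP sndF_mem_FP sndF_mem_FP
/-- `unW ∈ FP`. [cite: AroraBarakCC2009, §1.3] -/
theorem unW_mem_FP : unW ∈ FP := comp_mem_FP binToUnaryFn_mem_FP (fanoutFn_mem_FP id_mem_FP CliqueNP.ncF_mem_FP)

section Values

variable (n : ℕ) (G : SimpleGraph (Fin n)) (y : List Bool)

/-- The code of a graph, field by field. [cite: AroraBarakCC2009, §0.1] -/
theorem encode_eq : encodingGraph.encode ⟨n, G⟩ = boolPair (encodeNat n) (CliqueNP.adjBits n G) := by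
  rw [encodingGraph_encode, CliqueNP.encodingGraphFin_encode_eq]

/-- `n ≤ |⟨x, y⟩|` for the code `x` of a graph on `n` vertices. [folklore] -/
theorem le_length_pair : n ≤ (boolPair (encodingGraph.encode ⟨n, G⟩) y).length := by
  rw [length_boolPair, encode_eq, length_boolPair, CliqueNP.length_adjBits]
  nlinarith

/-- Value of the numeral field `CliqueNP.ncF` on a `HAMCIRCUIT` pair. [folklore] -/
@[simp] theorem ncF_pair : CliqueNP.ncF (boolPair (encodingGraph.encode ⟨n, G⟩) y) = encodeNat n := by
  simp [CliqueNP.ncF, encode_eq]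
/-- Value of the bit field `CliqueNP.bitsF` on a `HAMCIRCUIT` pair. [folklore] -/
@[simp] theorem bitsF_pair : CliqueNP.bitsF (boolPair (encodingGraph.encode ⟨n, G⟩) y) = CliqueNP.adjBits n G := by
  simp [CliqueNP.bitsF, encode_eq]
/-- Value of `hdrW`. [folklore] -/
@[simp] theorem hdrW_pair (x : List Bool) : hdrW (boolPair x y) = fstF y := by simp [hdrW]
/-- Value of `itemsW`. [folklore] -/
@[simp] theorem itemsW_pair (x : List Bool) : itemsW (boolPair x y) = sndF y := by simp [itemsW]
/-- Value of `unW`: `1ⁿ` (the ruler is long enough, `le_length_pair`). [folklore] -/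
@[simp] theorem unW_pair : unW (boolPair (encodingGraph.encode ⟨n, G⟩) y) = ones n := by
  have h := le_length_pair n G y
  rw [unW, Function.comp_apply, fanoutFn_apply, ncF_pair, binToUnaryFn_boolPair, bitsToNat_encodeNat]
  dsimp only [id]
  rw [min_eq_left h]

end Values

/-! ### The tests -/

/-- `[n = 1]`. [folklore] -/
def oneT : List Bool → List Bool := eqPairFn ∘ fanoutFn unW fun _ => ones 1
/-- `[3 ≤ n]`. [folklore] -/
def ge3T : List Bool → List Bool := lenLeFn X ∘ fanoutFn unW fun _ => ones 3
/-- `[y is a canonical list code]`. [folklore] -/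
def canYT : List Bool → List Bool := eqPairFn ∘ fanoutFn (canonListFn onesFn ∘ sndF) sndF
/-- `[the certificate has n items]` (header `= 1ⁿ`). [folklore] -/
def lenYT : List Bool → List Bool := eqPairFn ∘ fanoutFn hdrW unW
/-- `[every item is shorter than 1ⁿ]`. [folklore] -/
def ltT : List Bool → List Bool := allFn (ltLenF ∘ fanoutFn sndF fstF) ∘ fanoutFn unW itemsW
/-- `[the items are pairwise distinct]`. [folklore] -/
def ndT : List Bool → List Bool := nodupFn ∘ fanoutFn id itemsW
/-- The adjacency test of two items: on `⟨⟨1ⁿ, bits⟩, ⟨a, b⟩⟩`, the bit `bits[|b| + n |a|]`. [folklore] -/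
def adjC : List Bool → List Bool :=
  headBitFn ∘ bitAtFn ∘
    fanoutFn (appF ∘ fanoutFn (sndF ∘ sndF) (umulFn ∘ fanoutFn (fstF ∘ fstF) (fstF ∘ sndF))) (sndF ∘ fstF)
/-- `[consecutive items are adjacent]`. [folklore] -/
def chT : List Bool → List Bool := chainFn adjC ∘ fanoutFn (fanoutFn unW CliqueNP.bitsF) itemsW
/-- The first item. [folklore] -/
def firstW : List Bool → List Bool := fstF ∘ itemsW
/-- The item at position `n - 1` (the last one, for a certificate with `n` items). [folklore] -/
def lastW : List Bool → List Bool := nthItemFn ∘ fanoutFn (List.tail ∘ unW) itemsW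
/-- `[the last item is adjacent to the first]`: the bit `bits[|first| + n |last|]`. [folklore] -/
def wrapT : List Bool → List Bool :=
  headBitFn ∘ bitAtFn ∘ fanoutFn (appF ∘ fanoutFn firstW (umulFn ∘ fanoutFn unW lastW)) CliqueNP.bitsF

/-- **The verifier**: `n = 1`, or `n ≥ 3` and all the list tests.
[cite: AroraBarakCC2009, Thm. 2.17 (proof: the vertex list as certificate)] -/
def verifT : List Bool → List Bool :=
  orFn oneT (andFn ge3T (andFn canYT (andFn lenYT (andFn ltT (andFn ndT (andFn chT wrapT))))))

/-! #### Membership in `FP`, one bit -/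

/-- `oneT ∈ FP`. [cite: AroraBarakCC2009, §1.3] -/
theorem oneT_mem_FP : oneT ∈ FP := comp_mem_FP eqPairFn_mem_FP (fanoutFn_mem_FP unW_mem_FP (const_mem_FP _))
/-- `ge3T ∈ FP`. [cite: AroraBarakCC2009, §1.3] -/
theorem ge3T_mem_FP : ge3T ∈ FP := comp_mem_FP (lenLeFn_mem_FP X) (fanoutFn_mem_FP unW_mem_FP (const_mem_FP _))
/-- `canYT ∈ FP`. [cite: AroraBarakCC2009, §1.3] -/
theorem canYT_mem_FP : canYT ∈ FP :=
  comp_mem_FP eqPairFn_mem_FP (fanoutFn_mem_FP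
    (comp_mem_FP (canonListFn_mem_FP onesFn_mem_FP (a := 0) (fun u => by simp)) sndF_mem_FP) sndF_mem_FP)
/-- `lenYT ∈ FP`. [cite: AroraBarakCC2009, §1.3] -/
theorem lenYT_mem_FP : lenYT ∈ FP := comp_mem_FP eqPairFn_mem_FP (fanoutFn_mem_FP hdrW_mem_FP unW_mem_FP)
/-- `ltT ∈ FP`. [cite: AroraBarakCC2009, §1.3] -/
theorem ltT_mem_FP : ltT ∈ FP :=
  comp_mem_FP (allFn_mem_FP (comp_mem_FP ltLenF_mem_FP (fanoutFn_mem_FP sndF_mem_FP fstF_mem_FP))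
    (oneBit_ltLenF.comp _)) (fanoutFn_mem_FP unW_mem_FP itemsW_mem_FP)
/-- `ndT ∈ FP`. [cite: AroraBarakCC2009, §1.3] -/
theorem ndT_mem_FP : ndT ∈ FP := comp_mem_FP nodupFn_mem_FP (fanoutFn_mem_FP id_mem_FP itemsW_mem_FP)
/-- `adjC ∈ FP`. [cite: AroraBarakCC2009, §1.3] -/
theorem adjC_mem_FP : adjC ∈ FP :=
  comp_mem_FP headBitFn_mem_FP (comp_mem_FP bitAtFn_mem_FP (fanoutFn_mem_FP
    (comp_mem_FP appF_mem_FP (fanoutFn_mem_FP (comp_mem_FP sndF_mem_FP sndF_mem_FP)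
      (comp_mem_FP umulFn_mem_FP (fanoutFn_mem_FP (comp_mem_FP fstF_mem_FP fstF_mem_FP)
        (comp_mem_FP fstF_mem_FP sndF_mem_FP)))))
    (comp_mem_FP sndF_mem_FP fstF_mem_FP)))
/-- `chT ∈ FP`. [cite: AroraBarakCC2009, §1.3] -/
theorem chT_mem_FP : chT ∈ FP :=
  comp_mem_FP (chainFn_mem_FP adjC_mem_FP (oneBit_headBitFn.comp _))
    (fanoutFn_mem_FP (fanoutFn_mem_FP unW_mem_FP CliqueNP.bitsF_mem_FP) itemsW_mem_FP)
/-- `firstW ∈ FP`. [cite: AroraBarakCC2009, §1.3] -/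
theorem firstW_mem_FP : firstW ∈ FP := comp_mem_FP fstF_mem_FP itemsW_mem_FP
/-- `lastW ∈ FP`. [cite: AroraBarakCC2009, §1.3] -/
theorem lastW_mem_FP : lastW ∈ FP :=
  comp_mem_FP nthItemFn_mem_FP (fanoutFn_mem_FP (comp_mem_FP PRelSigma.tail_mem_FP unW_mem_FP) itemsW_mem_FP)
/-- `wrapT ∈ FP`. [cite: AroraBarakCC2009, §1.3] -/
theorem wrapT_mem_FP : wrapT ∈ FP :=
  comp_mem_FP headBitFn_mem_FP (comp_mem_FP bitAtFn_mem_FP (fanoutFn_mem_FP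
    (comp_mem_FP appF_mem_FP (fanoutFn_mem_FP firstW_mem_FP
      (comp_mem_FP umulFn_mem_FP (fanoutFn_mem_FP unW_mem_FP lastW_mem_FP)))) CliqueNP.bitsF_mem_FP))

/-- **`verifT ∈ FP`.** [cite: AroraBarakCC2009, §1.3] -/
theorem verifT_mem_FP : verifT ∈ FP :=
  orFn_mem_FP oneT_mem_FP (andFn_mem_FP ge3T_mem_FP (andFn_mem_FP canYT_mem_FP (andFn_mem_FP lenYT_mem_FP
    (andFn_mem_FP ltT_mem_FP (andFn_mem_FP ndT_mem_FP (andFn_mem_FP chT_mem_FP wrapT_mem_FP))))))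

/-- `oneT` is one-bit. [folklore] -/
theorem oneBit_oneT : OneBit oneT := oneBit_eqPairFn.comp _
/-- `ge3T` is one-bit. [folklore] -/
theorem oneBit_ge3T : OneBit ge3T := fun w => by
  rcases lenLeFn_eq_or X (fanoutFn unW (fun _ => ones 3) w) with h | h <;> exact ⟨_, h⟩
/-- `canYT` is one-bit. [folklore] -/
theorem oneBit_canYT : OneBit canYT := oneBit_eqPairFn.comp _
/-- `lenYT` is one-bit. [folklore] -/
theorem oneBit_lenYT : OneBit lenYT := oneBit_eqPairFn.comp _
/-- `ltT` is one-bit. [folklore] -/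
theorem oneBit_ltT : OneBit ltT := (oneBit_allFn (oneBit_ltLenF.comp _)).comp _
/-- `ndT` is one-bit. [folklore] -/
theorem oneBit_ndT : OneBit ndT := oneBit_nodupFn.comp _
/-- `adjC` is one-bit. [folklore] -/
theorem oneBit_adjC : OneBit adjC := oneBit_headBitFn.comp _
/-- `chT` is one-bit. [folklore] -/
theorem oneBit_chT : OneBit chT := (oneBit_chainFn adjC).comp _
/-- `wrapT` is one-bit. [folklore] -/
theorem oneBit_wrapT : OneBit wrapT := oneBit_headBitFn.comp _

/-- **`verifT` is one-bit.** [folklore] -/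
theorem oneBit_verifT : OneBit verifT :=
  oneBit_orFn oneBit_oneT (oneBit_andFn oneBit_ge3T (oneBit_andFn oneBit_canYT (oneBit_andFn oneBit_lenYT
    (oneBit_andFn oneBit_ltT (oneBit_andFn oneBit_ndT (oneBit_andFn oneBit_chT oneBit_wrapT))))))

/-- **The verifier language** and its membership in `P`. [cite: AroraBarakCC2009, Def. 1.13] -/
def verifLang : Language Bool := {w | verifT w = [true]}

/-- `verifLang ∈ P`. [cite: AroraBarakCC2009, Def. 1.13 and §1.3] -/
theorem verifLang_mem_P : verifLang ∈ Classes.P := CliqueNP.mem_P_of_oneBit verifT_mem_FP oneBit_verifT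

/-! ### Truth of the tests on the code of a graph -/

section Truth

variable (n : ℕ) (G : SimpleGraph (Fin n))

/-- `[decide P] = [1] ↔ P`. [folklore] -/
theorem singleton_decide_eq_true_iff {P : Prop} [Decidable P] : [decide P] = [true] ↔ P := by simp

/-- Truth of `oneT`. [folklore] -/
theorem oneT_true_iff (y : List Bool) : oneT (boolPair (encodingGraph.encode ⟨n, G⟩) y) = [true] ↔ n = 1 := by
  rw [oneT, Function.comp_apply, fanoutFn_apply, unW_pair, eqPairFn_boolPair, singleton_decide_eq_true_iff,
    CliqueNP.ones_inj]

/-- Truth of `ge3T`. [folklore] -/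
theorem ge3T_true_iff (y : List Bool) : ge3T (boolPair (encodingGraph.encode ⟨n, G⟩) y) = [true] ↔ 3 ≤ n := by
  rw [ge3T, Function.comp_apply, fanoutFn_apply, unW_pair, lenLeFn_boolPair]
  simp [ones]

/-- Truth of `canYT`. [folklore] -/
theorem canYT_true_iff (x y : List Bool) : canYT (boolPair x y) = [true] ↔ ∃ l : List ℕ, y = listCode l := by
  rw [canYT, Function.comp_apply, fanoutFn_apply, Function.comp_apply, sndF_boolPair, eqPairFn_boolPair]
  simp [canonListFn_onesFn_eq_self_iff]

variable (l : List ℕ)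

/-- Truth of `lenYT` on a list code. [folklore] -/
theorem lenYT_true_iff :
    lenYT (boolPair (encodingGraph.encode ⟨n, G⟩) (listCode l)) = [true] ↔ l.length = n := by
  rw [lenYT, Function.comp_apply, fanoutFn_apply, hdrW_pair, unW_pair, listCode_eq, fstF_boolPair,
    eqPairFn_boolPair, singleton_decide_eq_true_iff, CliqueNP.ones_inj]

/-- Truth of `ltT` on a list code. [folklore] -/
theorem ltT_true_iff :
    ltT (boolPair (encodingGraph.encode ⟨n, G⟩) (listCode l)) = [true] ↔ ∀ v ∈ l, v < n := by
  rw [ltT, Function.comp_apply, fanoutFn_apply, unW_pair, itemsW_pair, listCode_eq, sndF_boolPair,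
    allFn_boolPair_eq_true (oneBit_ltLenF.comp _), decNil_encList]
  simp [ones]

/-- Truth of `ndT` on a list code. [folklore] -/
theorem ndT_true_iff (x : List Bool) : ndT (boolPair x (listCode l)) = [true] ↔ l.Nodup := by
  rw [ndT, Function.comp_apply, fanoutFn_apply, itemsW_pair, listCode_eq, sndF_boolPair, nodupFn_encList_eq_true,
    List.nodup_map_iff fun a b h => CliqueNP.ones_inj.1 h]

open Classical in
/-- The adjacency bit read at `1^{v + n u}`. [folklore] -/
theorem headBitFn_bitAtFn_adjBits {u v : ℕ} (hu : u < n) (hv : v < n) :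
    headBitFn (bitAtFn (boolPair (ones v ++ ones (n * u)) (CliqueNP.adjBits n G))) =
      [decide (G.Adj ⟨u, hu⟩ ⟨v, hv⟩)] := by
  have e := CliqueNP.getD_adjBits_flat G ⟨u, hu⟩ ⟨v, hv⟩
  have hlen : (ones v ++ ones (n * u)).length = u * n + v := by
    simp only [List.length_append, List.length_replicate]; ring
  rw [bitAtFn_boolPair, headBitFn_apply, CliqueNP.headD_take_one_drop, hlen, e]

open Classical in
/-- Value of the item adjacency test on two numerals below `n`. [folklore] -/
theorem adjC_apply {u v : ℕ} (hu : u < n) (hv : v < n) :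
    adjC (boolPair (boolPair (ones n) (CliqueNP.adjBits n G)) (boolPair (ones u) (ones v))) =
      [decide (G.Adj ⟨u, hu⟩ ⟨v, hv⟩)] := by
  classical
  rw [← headBitFn_bitAtFn_adjBits n G hu hv]
  simp [adjC]

/-- Truth of `chT` on a list code of numbers below `n`. [folklore] -/
theorem chT_true_iff (h : ∀ v ∈ l, v < n) :
    chT (boolPair (encodingGraph.encode ⟨n, G⟩) (listCode l)) = [true] ↔
      List.IsChain (fun u v => ∃ (hu : u < n) (hv : v < n), G.Adj ⟨u, hu⟩ ⟨v, hv⟩) l := by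
  classical
  rw [chT, Function.comp_apply, fanoutFn_apply, fanoutFn_apply, unW_pair, bitsF_pair, itemsW_pair, listCode_eq,
    sndF_boolPair, chainFn_encList_eq_true oneBit_adjC, List.isChain_map]
  exact List.IsChain.iff_of_mem_imp fun a b ha hb => by
    rw [adjC_apply n G (h a ha) (h b hb)]
    simp [h a ha, h b hb]

variable {n l}

/-- Value of `firstW` on a nonempty list code: `1^{l₀}`. [folklore] -/
theorem firstW_listCode (x : List Bool) (hl : 0 < l.length) :
    firstW (boolPair x (listCode l)) = ones (l[0]) := by
  rw [firstW, Function.comp_apply, itemsW_pair, listCode_eq, sndF_boolPair, Brick.fstF_encList]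
  obtain ⟨a, l', rfl⟩ := List.exists_cons_of_length_pos hl
  rfl

/-- Value of `lastW` on a list code with `n` items: `1^{l_{n-1}}`. [folklore] -/
theorem lastW_listCode (hl : l.length = n) (hn : 0 < n) :
    lastW (boolPair (encodingGraph.encode ⟨n, G⟩) (listCode l)) = ones (l[n - 1]'(by omega)) := by
  rw [lastW, Function.comp_apply, fanoutFn_apply, Function.comp_apply, unW_pair, itemsW_pair, listCode_eq,
    sndF_boolPair, nthItemFn_boolPair, List.tail_replicate, List.length_replicate, Brick.sndF_iterate_encList,
    Brick.fstF_encList, ← List.map_drop]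
  have hd : l.drop (n - 1) = l[n - 1]'(by omega) :: l.drop (n - 1 + 1) := List.drop_eq_getElem_cons (by omega)
  rw [hd]
  rfl

/-- Truth of `wrapT` on a list code with `n > 0` items below `n`. [folklore] -/
theorem wrapT_true_iff (hl : l.length = n) (hn : 0 < n) (h : ∀ v ∈ l, v < n) :
    wrapT (boolPair (encodingGraph.encode ⟨n, G⟩) (listCode l)) = [true] ↔
      G.Adj ⟨l[n - 1]'(by omega), h _ (List.getElem_mem _)⟩ ⟨l[0]'(by omega), h _ (List.getElem_mem _)⟩ := by
  classical
  rw [wrapT, Function.comp_apply, Function.comp_apply, fanoutFn_apply, Function.comp_apply, fanoutFn_apply,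
    Function.comp_apply, fanoutFn_apply, firstW_listCode _ (by omega), unW_pair, lastW_listCode G hl hn,
    umulFn_boolPair, appF_boolPair, bitsF_pair,
    headBitFn_bitAtFn_adjBits n G (h _ (List.getElem_mem _)) (h _ (List.getElem_mem _))]
  simp

/-- **The property of the vertex list certified by the verifier** (for `n ≥ 3`): `n` numbers below
`n`, pairwise distinct, consecutive ones adjacent, the last adjacent to the first.
[cite: AroraBarakCC2009, Thm. 2.17 (proof: the vertex list as certificate)] -/
def GoodList (n : ℕ) (G : SimpleGraph (Fin n)) (l : List ℕ) : Prop :=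
  ∃ (hl : l.length = n) (h3 : 3 ≤ n) (h : ∀ v ∈ l, v < n), l.Nodup ∧
    List.IsChain (fun u v => ∃ (hu : u < n) (hv : v < n), G.Adj ⟨u, hu⟩ ⟨v, hv⟩) l ∧
    G.Adj ⟨l[n - 1]'(by omega), h _ (List.getElem_mem _)⟩ ⟨l[0]'(by omega), h _ (List.getElem_mem _)⟩

variable (n)

/-- **Truth of the verifier on the code of any graph paired with any string.**
[cite: AroraBarakCC2009, Thm. 2.17 (proof)] [cite: Karp1972, §4 Main Theorem, problem 10] -/
theorem verifT_encode_true_iff (y : List Bool) :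
    verifT (boolPair (encodingGraph.encode ⟨n, G⟩) y) = [true] ↔
      n = 1 ∨ ∃ l : List ℕ, y = listCode l ∧ GoodList n G l := by
  rw [verifT, orFn_eq_true_iff oneBit_oneT (oneBit_andFn oneBit_ge3T (oneBit_andFn oneBit_canYT
      (oneBit_andFn oneBit_lenYT (oneBit_andFn oneBit_ltT (oneBit_andFn oneBit_ndT (oneBit_andFn oneBit_chT
        oneBit_wrapT)))))),
    andFn_eq_true_iff oneBit_ge3T (oneBit_andFn oneBit_canYT (oneBit_andFn oneBit_lenYT (oneBit_andFn oneBit_ltT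
      (oneBit_andFn oneBit_ndT (oneBit_andFn oneBit_chT oneBit_wrapT))))),
    andFn_eq_true_iff oneBit_canYT (oneBit_andFn oneBit_lenYT (oneBit_andFn oneBit_ltT (oneBit_andFn oneBit_ndT
      (oneBit_andFn oneBit_chT oneBit_wrapT)))),
    andFn_eq_true_iff oneBit_lenYT (oneBit_andFn oneBit_ltT (oneBit_andFn oneBit_ndT (oneBit_andFn oneBit_chT
      oneBit_wrapT))),
    andFn_eq_true_iff oneBit_ltT (oneBit_andFn oneBit_ndT (oneBit_andFn oneBit_chT oneBit_wrapT)),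
    andFn_eq_true_iff oneBit_ndT (oneBit_andFn oneBit_chT oneBit_wrapT),
    andFn_eq_true_iff oneBit_chT oneBit_wrapT,
    oneT_true_iff, ge3T_true_iff, canYT_true_iff]
  constructor
  · rintro (h1 | ⟨h3, ⟨l, rfl⟩, hlen, hlt, hnd, hch, hwr⟩)
    · exact Or.inl h1
    · rw [lenYT_true_iff] at hlen
      rw [ltT_true_iff] at hlt
      rw [ndT_true_iff] at hnd
      rw [chT_true_iff n G l hlt] at hch
      rw [wrapT_true_iff G hlen (by omega) hlt] at hwr
      exact Or.inr ⟨l, rfl, hlen, h3, hlt, hnd, hch, hwr⟩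
  · rintro (h1 | ⟨l, rfl, hlen, h3, hlt, hnd, hch, hwr⟩)
    · exact Or.inl h1
    · refine Or.inr ⟨h3, ⟨l, rfl⟩, ?_, ?_, ?_, ?_, ?_⟩
      · rwa [lenYT_true_iff]
      · rwa [ltT_true_iff]
      · rwa [ndT_true_iff]
      · rwa [chT_true_iff n G l hlt]
      · rwa [wrapT_true_iff G hlen (by omega) hlt]

end Truth

/-! ### Good lists and Hamiltonian cycles -/

section Lists

variable {n : ℕ} {G : SimpleGraph (Fin n)}

/-- **Soundness**: a good list is (the value list of) a Hamiltonian cycle listing, so the graph is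
Hamiltonian. [cite: AroraBarakCC2009, Thm. 2.17 (proof)] -/
theorem isHamiltonian_of_goodList {l : List ℕ} (hg : GoodList n G l) : G.IsHamiltonian := by
  obtain ⟨hl, h3, h, hnd, hch, hwr⟩ := hg
  set L : List (Fin n) := l.pmap Fin.mk h with hL
  have hLlen : L.length = n := by rw [hL, List.length_pmap, hl]
  have hLget : ∀ (i : ℕ) (hi : i < L.length), L[i] = ⟨l[i]'(by rw [hL, List.length_pmap] at hi; exact hi),
      h _ (List.getElem_mem _)⟩ := fun i hi => by
    simp [hL, List.getElem_pmap]
  have hlist : IsHamCycleListing G.Adj L := by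
    refine ⟨hnd.pmap fun a _ b _ hab => Fin.mk.inj_iff.1 hab, fun v => ?_, fun i hi => ?_⟩
    · -- full length and no duplicates: every vertex occurs
      have hnd' : L.Nodup := hnd.pmap fun a _ b _ hab => Fin.mk.inj_iff.1 hab
      have huniv : L.toFinset = Finset.univ :=
        Finset.eq_univ_of_card _ (by rw [List.toFinset_card_of_nodup hnd', hLlen, Fintype.card_fin])
      exact List.mem_toFinset.1 (huniv ▸ Finset.mem_univ v)
    · rw [hLget, hLget]
      by_cases hlast : i + 1 < L.length
      · have hc := List.isChain_iff_getElem.1 hch i (by rw [hLlen] at hlast; omega)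
        obtain ⟨_, _, hc⟩ := hc
        simp only [Nat.mod_eq_of_lt hlast]
        exact hc
      · have hi' : i = n - 1 := by rw [hLlen] at hi hlast; omega
        subst hi'
        have h1 : (n - 1 + 1) % L.length = 0 := by rw [hLlen, Nat.sub_add_cancel (by omega), Nat.mod_self]
        simp only [h1]
        exact hwr
  exact hlist.isHamiltonian (by rw [hLlen]; exact h3)

/-- **Completeness**: a Hamiltonian graph on `n ≠ 1` vertices has a good list (the values of a
Hamiltonian cycle listing). [cite: AroraBarakCC2009, Thm. 2.17 (proof)] -/
theorem exists_goodList_of_isHamiltonian (hG : G.IsHamiltonian) (hn : n ≠ 1) : ∃ l : List ℕ, GoodList n G l := by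
  rcases (isHamiltonian_iff_exists_isHamCycleListing G).1 hG with h1 | ⟨L, h3, hL⟩
  · rw [Fintype.card_fin] at h1; exact absurd h1 hn
  · have hlen : L.length = n := by rw [hL.length_eq, Fintype.card_fin]
    refine ⟨L.map Fin.val, ?_⟩
    have hl : (L.map Fin.val).length = n := by rw [List.length_map, hlen]
    have h : ∀ v ∈ L.map Fin.val, v < n := fun v hv => by
      obtain ⟨a, -, rfl⟩ := List.mem_map.1 hv; exact a.2
    refine ⟨hl, hlen ▸ h3, h, (List.nodup_map_iff Fin.val_injective).2 hL.nodup, ?_, ?_⟩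
    · rw [List.isChain_map]
      refine List.isChain_iff_getElem.2 fun i hi => ⟨(L[i]).2, (L[i + 1]).2, ?_⟩
      exact hL.rel_succ i hi
    · have hw := hL.rel_last_zero (by omega)
      simp only [List.getElem_map, Fin.eta, hlen] at hw ⊢
      exact hw

/-- The code of a graph has length at least `n² + 2`. [folklore] -/
theorem nsq_add_two_le_length_encode (n : ℕ) (G : SimpleGraph (Fin n)) :
    n * n + 2 ≤ (encodingGraph.encode ⟨n, G⟩).length := by
  rw [encode_eq, length_boolPair, CliqueNP.length_adjBits]; omega

end Lists

/-! ### `HAMCIRCUIT ∈ NP` -/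

/-- **The certificate form of Hamiltonicity over `gcodeLang`** (witness length `≤ 4|x| + 2`).
[cite: Karp1972, §3 Def. 4 (NP by p-bounded existential quantification)] [cite: AroraBarakCC2009, Def. 2.1] -/
def witnessLang : Language Bool :=
  {x | ∃ y : List Bool, y.length ≤ (C 4 * X + C 2 : Polynomial ℕ).eval x.length ∧ boolPair x y ∈ verifLang}

/-- `witnessLang ∈ NP`. [cite: AroraBarakCC2009, Def. 2.1] -/
theorem witnessLang_mem_NP : witnessLang ∈ Nondeterministic.NP :=
  ⟨verifLang, verifLang_mem_P, C 4 * X + C 2, fun _ => Iff.rfl⟩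

/-- **`HAMCIRCUIT` is the intersection of the graph-code language with the certificate language.**
[cite: Karp1972, §4 Main Theorem, problem 10] [cite: AroraBarakCC2009, Thm. 2.17 (proof)] -/
theorem HAMCIRCUIT_eq_inter : HAMCIRCUIT = gcodeLang ⊓ witnessLang := by
  ext x
  constructor
  · rintro ⟨⟨n, G⟩, hmem, rfl⟩
    have hham : G.IsHamiltonian := hmem
    refine ⟨(mem_gcodeLang_iff _).2 ⟨n, G, rfl⟩, ?_⟩
    by_cases hn : n = 1
    · refine ⟨[], by simp, ?_⟩
      change verifT _ = [true]
      rw [verifT_encode_true_iff]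
      exact Or.inl hn
    · obtain ⟨l, hg⟩ := exists_goodList_of_isHamiltonian hham hn
      obtain ⟨hl, -, h, -⟩ := id hg
      refine ⟨listCode l, ?_, ?_⟩
      · have h1 := length_listCode_le hl h
        have h2 := nsq_add_two_le_length_encode n G
        simp only [eval_add, eval_mul, eval_C, eval_X]
        nlinarith
      · change verifT _ = [true]
        rw [verifT_encode_true_iff]
        exact Or.inr ⟨l, rfl, hg⟩
  · rintro ⟨hcode, y, -, hacc⟩
    obtain ⟨n, G, rfl⟩ := (mem_gcodeLang_iff x).1 hcode
    change verifT _ = [true] at hacc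
    rw [verifT_encode_true_iff] at hacc
    refine ⟨⟨n, G⟩, ?_, rfl⟩
    show G.IsHamiltonian
    rcases hacc with h1 | ⟨l, -, hg⟩
    · exact SimpleGraph.IsHamiltonian.of_card_eq_one (by rw [Fintype.card_fin, h1])
    · exact isHamiltonian_of_goodList hg

/-- **`HAMCIRCUIT ∈ NP`** (membership half of `isNPComplete_HAMCIRCUIT`; Karp 1972: "It is clear that
these problems … are all in NP"): a `P` language intersected with a language in certificate form over
a `P` verifier (`inter_P_mem_polyExists`). [cite: Karp1972, §4 Main Theorem, problem 10]
[cite: AroraBarakCC2009, Def. 2.1 and Thm. 2.17 (proof)] -/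
theorem HAMCIRCUIT_mem_NP : HAMCIRCUIT ∈ Nondeterministic.NP := by
  rw [HAMCIRCUIT_eq_inter]
  exact inter_P_mem_polyExists (K := Classes.P) (fun _ _ a b => inter_mem_P a b) gcodeLang_mem_P witnessLang_mem_NP

end HamNP

/-- **`HAMCIRCUIT ∈ NP`** (Karp 1972, §4: the problems of the Main Theorem "are all in NP"; here
problem 10, HAMILTON CIRCUIT, for the tree's `HAMCIRCUIT = encodingGraph.toLanguage hamCircuitSet`).
[cite: Karp1972, §4 Main Theorem, problem 10] -/
theorem HAMCIRCUIT_mem_NP : HAMCIRCUIT ∈ Nondeterministic.NP := HamNP.HAMCIRCUIT_mem_NP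




end Literature.Computability.Complexity

end
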